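import Summits.QuantumFields.YangMills.Theorems.UnitScaleTiltFluctuationComparisonRegPrCertReflect

/-!
# Route `UnitScaleTilt` — crux `FluctuationComparisonRegPrL` (stmt-QuantumFields-19935), stub `stub_oneStepSmallLift`, piece (L2):
# GENERIC KERNEL-REFLECTION LEMMAS, sequel — keyed masses and bond fibres (support file `--supports stmt-QuantumFields-19935`)

Fleet seat `ym-ust-19201-p2` gen 5 (OWNER RULING g20-№9 §3, task «DE-NATIVE CertL3Tree»), continuation of `…CertReflect`:

* §5 the fibrewise (`keyed`) `ℓ¹` mass `Σ_keys |Σ_fibre c|` of a finitely indexed coefficient family is bounded by the GROUPED mass of any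
  list of (encoded key, coefficient) pairs with the same fibre sums (`keyed_le_listMass`), and fibre sums ignore zero coefficients;
* §6 the first-order ENCODED KEY `encKey` (orientation index, three displacement coordinates) and the ENTRY-DRIVEN bond fibre sums
  (`bond_fiber`, `bond_fiber_shift`): the fibre over an encoded key of a kernel-table row is an `ite`-sum over the sparse entry list.

Elementary bookkeeping; nothing of Bałaban's is asserted.
-/

open scoped BigOperators

namespace Summit.QuantumFields.YangMills.Theorems.ApproxLift.CertReflect

open Summit.QuantumFields.YangMills.Theorems.ApproxLift

/-! ## §5 The fibrewise (keyed) mass against the grouped mass of a (key, coefficient) list -/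

/-- Dropping the indices with zero coefficient does not change a fibre sum (the rational twin of the support restriction). -/
theorem sum_filter_subtype_ne_zero {ι : Type*} [Fintype ι] (c : ι → ℚ) (P : ι → Prop) [DecidablePred P]
    [DecidablePred fun i => c i ≠ 0] :
    (∑ j ∈ (Finset.univ : Finset {i // c i ≠ 0}).filter (fun j => P j.1), c j.1) = ∑ i ∈ Finset.univ.filter P, c i := by
  classical
  rw [Finset.sum_filter, Finset.sum_filter]
  rw [← Finset.sum_subtype (s := Finset.univ.filter fun i => c i ≠ 0) (p := fun i => c i ≠ 0) (fun i => by simp)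
      (f := fun i => if P i then c i else 0)]
  exact Finset.sum_filter_of_ne (fun i _ hne => by
    intro h0
    apply hne
    simp [h0])

/-- **KEYED MASS ≤ GROUPED LIST MASS.**  If the fibre sums of `(c, key)` through an injective key encoding `enc` are the fibre sums of a list
`Λ` of (encoded key, coefficient) pairs, then the fibrewise `ℓ¹` mass of `(c, key)` is at most the grouped `ℓ¹` mass of `Λ` (keys of `Λ`
outside the image only add nonnegative terms). -/
theorem keyed_le_listMass {ι κ K : Type*} [Fintype ι] [DecidableEq κ] [DecidableEq K]
    (c : ι → ℚ) (key : ι → κ) (enc : κ → K) (henc : Function.Injective enc) (Λ : List (K × ℚ))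
    (H : ∀ kc, (∑ i ∈ Finset.univ.filter (fun i => enc (key i) = kc), c i) = ((Λ.filter fun l => l.1 = kc).map Prod.snd).sum) :
    (∑ k ∈ Finset.univ.image key, |∑ i ∈ Finset.univ.filter (fun i => key i = k), c i|) ≤
      ((Λ.map Prod.fst).dedup.map fun kc => |((Λ.filter fun l => l.1 = kc).map Prod.snd).sum|).sum := by
  classical
  have hfib : ∀ k, (∑ i ∈ Finset.univ.filter (fun i => key i = k), c i) =
      ((Λ.filter fun l => l.1 = enc k).map Prod.snd).sum := by
    intro k
    rw [← H]
    refine Finset.sum_congr ?_ (fun _ _ => rfl)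
    ext i
    simp only [Finset.mem_filter, Finset.mem_univ, true_and, henc.eq_iff]
  rw [Finset.sum_congr rfl (fun k _ => by rw [hfib k])]
  rw [← Finset.sum_image (f := fun kc => |((Λ.filter fun l => l.1 = kc).map Prod.snd).sum|) (fun x _ y _ hxy => henc hxy)]
  have hzero : ∀ kc, kc ∉ (Λ.map Prod.fst).toFinset → ((Λ.filter fun l => l.1 = kc).map Prod.snd).sum = 0 := by
    intro kc hkc
    rw [List.filter_eq_nil_iff.2, List.map_nil, List.sum_nil]
    intro l hl hlk
    exact hkc (List.mem_toFinset.2 (List.mem_map.2 ⟨l, hl, of_decide_eq_true hlk⟩))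
  calc (∑ kc ∈ (Finset.univ.image key).image enc, |((Λ.filter fun l => l.1 = kc).map Prod.snd).sum|)
      = ∑ kc ∈ ((Finset.univ.image key).image enc).filter (fun kc => kc ∈ (Λ.map Prod.fst).toFinset),
          |((Λ.filter fun l => l.1 = kc).map Prod.snd).sum| := by
        refine (Finset.sum_filter_of_ne (fun kc _ hne => ?_)).symm
        by_contra hkc
        exact hne (by rw [hzero kc hkc, abs_zero])
    _ ≤ ∑ kc ∈ (Λ.map Prod.fst).toFinset, |((Λ.filter fun l => l.1 = kc).map Prod.snd).sum| :=
        Finset.sum_le_sum_of_subset_of_nonneg (fun kc hkc => (Finset.mem_filter.1 hkc).2) (fun _ _ _ => abs_nonneg _)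
    _ = ((Λ.map Prod.fst).dedup.map fun kc => |((Λ.filter fun l => l.1 = kc).map Prod.snd).sum|).sum := by
        have hd : ((Λ.map Prod.fst).dedup).toFinset = (Λ.map Prod.fst).toFinset := by
          ext x; simp [List.mem_dedup]
        rw [← hd, List.sum_toFinset _ (List.nodup_dedup _)]


/-! ## §6 Encoded keys and the bond fibre sums -/

/-- ENCODED KEY: (orientation index, the three displacement coordinates) — a first-order key for the kernel computation. -/
def encKey (oi : Orient 3 → ℕ) (κ : Key 3) : ℕ × ℤ × ℤ × ℤ := (oi κ.1, κ.2 0, κ.2 1, κ.2 2)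

/-- `encKey` is injective when the orientation index is. -/
theorem encKey_injective (oi : Orient 3 → ℕ) (hoi : Function.Injective oi) : Function.Injective (encKey oi) := by
  rintro ⟨o, z⟩ ⟨o', z'⟩ hh
  simp only [encKey, Prod.mk.injEq] at hh
  obtain ⟨ho, h0, h1, h2⟩ := hh
  exact Prod.ext (hoi ho) (vec3_eq h0 h1 h2)

/-- The encoded key of a (shifted) bond index. -/
theorem encKey_shift (oi : Orient 3 → ℕ) (o : Orient 3) (s : Fin 3 → ℤ) (k : Fin 3 → Fin (2 * 2 + 1)) :
    encKey oi (o, s + kvec 2 k) =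
      (oi o, s 0 + (((k 0 : ℕ) : ℤ) - 2), s 1 + (((k 1 : ℕ) : ℤ) - 2), s 2 + (((k 2 : ℕ) : ℤ) - 2)) := by
  simp only [encKey, Pi.add_apply, kvec, Nat.cast_ofNat]

/-- The encoded key of an unshifted bond index. -/
theorem encKey_kvec (oi : Orient 3 → ℕ) (o : Orient 3) (k : Fin 3 → Fin (2 * 2 + 1)) :
    encKey oi (o, kvec 2 k) = (oi o, ((k 0 : ℕ) : ℤ) - 2, ((k 1 : ℕ) : ℤ) - 2, ((k 2 : ℕ) : ℤ) - 2) := by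
  simp only [encKey, kvec, Nat.cast_ofNat]

section Bond

variable {α : Type*} (fa fp0 fp1 fp2 fo fk0 fk1 fk2 : α → ℕ) (fv : α → ℤ) (oi : Orient 3 → ℕ) {L : ℕ}

/-- **BOND FIBRE SUM, ENTRY-DRIVEN** (shifted key): the fibre over an encoded key of `(o, k) ↦ r · (pushed-forward table value at (d, q, o, k))`
keyed by `(o, s + kvec k)` is the `ite`-sum over the entries with direction `d` and offsets `q` whose encoded key matches. -/
theorem bond_fiber_shift (hoi : Function.Injective oi) (hos : ∀ n, n < 3 → ∃ o : Orient 3, oi o = n) (E : List α)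
    (hE : ∀ e ∈ E, fo e < 3 ∧ fk0 e < 2 * 2 + 1 ∧ fk1 e < 2 * 2 + 1 ∧ fk2 e < 2 * 2 + 1)
    (d : Fin 3) (q : Fin 3 → Fin L) (s : Fin 3 → ℤ) (r : ℚ) (kc : ℕ × ℤ × ℤ × ℤ) :
    (∑ o : Orient 3, ∑ k : Fin 3 → Fin (2 * 2 + 1),
        if encKey oi (o, s + kvec 2 k) = kc then
          r * (E.map fun e => if (fa e == (d : ℕ) && fp0 e == (q 0 : ℕ) && fp1 e == (q 1 : ℕ) && fp2 e == (q 2 : ℕ) && fo e == oi o &&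
              fk0 e == (k 0 : ℕ) && fk1 e == (k 1 : ℕ) && fk2 e == (k 2 : ℕ)) = true then (fv e : ℚ) else 0).sum
        else 0) =
      (E.map fun e => if fa e = d ∧ fp0 e = q 0 ∧ fp1 e = q 1 ∧ fp2 e = q 2 then
          (if (fo e, s 0 + ((fk0 e : ℤ) - 2), s 1 + ((fk1 e : ℤ) - 2), s 2 + ((fk2 e : ℤ) - 2)) = kc then r * (fv e : ℚ) else 0)
        else 0).sum := by
  simp_rw [ite_mul_sum_map, finset_sum_list_sum]
  refine congrArg List.sum (List.map_congr_left fun e he => ?_)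
  obtain ⟨ho, hk0, hk1, hk2⟩ := hE e he
  obtain ⟨o₀, hoo⟩ := hos _ ho
  obtain ⟨k₀, e0, e1, e2⟩ := exists_vec3 _ _ _ hk0 hk1 hk2
  rw [collapse_ok fa fp0 fp1 fp2 fo fk0 fk1 fk2 oi hoi e
    (fun o k => if encKey oi (o, s + kvec 2 k) = kc then r * (fv e : ℚ) else 0) d q o₀ k₀ hoo.symm e0 e1 e2]
  simp only [encKey_shift, hoo, ← e0, ← e1, ← e2]

/-- **BOND FIBRE SUM, ENTRY-DRIVEN** (unshifted key). -/
theorem bond_fiber (hoi : Function.Injective oi) (hos : ∀ n, n < 3 → ∃ o : Orient 3, oi o = n) (E : List α)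
    (hE : ∀ e ∈ E, fo e < 3 ∧ fk0 e < 2 * 2 + 1 ∧ fk1 e < 2 * 2 + 1 ∧ fk2 e < 2 * 2 + 1)
    (d : Fin 3) (q : Fin 3 → Fin L) (r : ℚ) (kc : ℕ × ℤ × ℤ × ℤ) :
    (∑ o : Orient 3, ∑ k : Fin 3 → Fin (2 * 2 + 1),
        if encKey oi (o, kvec 2 k) = kc then
          r * (E.map fun e => if (fa e == (d : ℕ) && fp0 e == (q 0 : ℕ) && fp1 e == (q 1 : ℕ) && fp2 e == (q 2 : ℕ) && fo e == oi o &&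
              fk0 e == (k 0 : ℕ) && fk1 e == (k 1 : ℕ) && fk2 e == (k 2 : ℕ)) = true then (fv e : ℚ) else 0).sum
        else 0) =
      (E.map fun e => if fa e = d ∧ fp0 e = q 0 ∧ fp1 e = q 1 ∧ fp2 e = q 2 then
          (if (fo e, ((fk0 e : ℤ) - 2), ((fk1 e : ℤ) - 2), ((fk2 e : ℤ) - 2)) = kc then r * (fv e : ℚ) else 0)
        else 0).sum := by
  simp_rw [ite_mul_sum_map, finset_sum_list_sum]
  refine congrArg List.sum (List.map_congr_left fun e he => ?_)
  obtain ⟨ho, hk0, hk1, hk2⟩ := hE e he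
  obtain ⟨o₀, hoo⟩ := hos _ ho
  obtain ⟨k₀, e0, e1, e2⟩ := exists_vec3 _ _ _ hk0 hk1 hk2
  rw [collapse_ok fa fp0 fp1 fp2 fo fk0 fk1 fk2 oi hoi e
    (fun o k => if encKey oi (o, kvec 2 k) = kc then r * (fv e : ℚ) else 0) d q o₀ k₀ hoo.symm e0 e1 e2]
  simp only [encKey_kvec, hoo, ← e0, ← e1, ← e2]

end Bond

end Summit.QuantumFields.YangMills.Theorems.ApproxLift.CertReflect
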